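import Literature.AlgebraicGeometry.HodgeTheory.WeilClassesRigidObstruction
import Literature.AlgebraicGeometry.HodgeTheory.SchoenCurveBuiltCycles
import HarnessLib

/-!
# The SCHOEN RIGIDITY conjecture (R) and its door theorem (crux `BlochSeedDiscThree` = `HasHyperbolicBlochSeed 4 3`, negative side)

`SchoenRigidity` (R): on the CM Prym eightfold `B₁ = X₄₈^{new}(1,5,42)` with its `√-3`-multiplication `ψ₀`
(`ψ₀ = 2 s¹⁶ + 1` restricted to the new part), EVERY Schoen cycle (`SchoenCycleAt`: integral, codimension exactly 4,
norm-built from the curve, carrying `q·h_K⁴ + w` with `w ≠ 0` a rational Weil class) is `WeilRigidObstructed 8 4 3`: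
some `√-3`-Weil family through `B₁` keeps the class Hodge while `Z` admits no étale-local flat lift along it.
Heuristic of record (CENSUS-R2 §9.1, kit j243567/j243868/j244558): the liftable first-order directions at `B₁` are the
Prym directions, of rank 10 in the 16-dimensional Weil locus `Sh¹⁶` (germ: the 12-dimensional Prym image), so the
expected deficit is 6 to first order (4 for the germ); the GAP (R¹) is the exactness statement «no accidental liftable
non-Prym direction» (D4-EXACT), not proved here — (R) is recorded as a CONJECTURE (`@[conjecture]`).

`SchoenRigidityHyp` (Rʰ) is (R) restricted to HYPERBOLIC RATIONAL frames (`a` rational, `a ≠ 0`,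
`IsHyperbolicWeilType B₁ ψ₀ 4 h_K`); `(R) → (Rʰ)` is proved. Door theorem `schoenCycle_not_blochSemiregular`: granting
`Bloch1972_semiregularSubschemeLifts`, (R) implies that no l.c.i. Schoen cycle witnesses `HasBlochSeedAt 4 B₁ h_K w`
(so Schoen's geometry yields no `HasHyperbolicBlochSeed 4 3` witness). The converse side — ¬(Rʰ) gives
`HasLocallyAlgebraicWeilAnchor 4 3` — is `BlochSeedDiscThreeLiftableDoor.lean`.

References: [cite: Schoen1988HodgeWeil, §2–3] [cite: Bloch1972Semiregularity, Thm. (7.1), (7.4)] [cite: Artin1969, Cor. (2.2)]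
[cite: LangeSernesi2004HilbertPrym, Thm. 1.1–1.2 (arXiv:math/0206248: Abel–Prym curves are obstructed exactly where
infinitesimal Prym–Torelli fails — the print shape of gap (R¹))] [cite: VoisinTorino1994, Lect. 7 §2, Thms. 2.3–2.4 (obstructions to deforming pairs)].

Provenance: cell `hodge-schoen` round 3 «(R) RIGIDITY» (director-hodge 2026-08-25T19:27:28Z); memos of record
`run/shared/lean/pub/hodge-schoen/memos/ROUND-3-RIGIDITY.md` (85fcfe7848962e66), `ROUND-3-Rigidity.lean` (b3cbc3497475185a, plan g5),
`ROUND-3-RigidityDichotomy.lean` (fd65c70677d60b95, plan g6), `ROUND-3-ADDENDUM-g6.md`; referee audit REFEREE-REPORT.md §J (r1–r5 PASS).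
Supports item `stmt-HodgeConjecture-18882` (`EightfoldBlochSeeds.BlochSeedDiscThree := HasHyperbolicBlochSeed 4 3`).
-/

noncomputable section
set_option linter.dupNamespace false
open CategoryTheory CategoryTheory.Limits AlgebraicGeometry MonoidalCategory Polynomial
open Literature.AlgebraicGeometry Literature.AlgebraicGeometry.Motives
open Literature.AlgebraicGeometry.Deformation
open Literature.AlgebraicGeometry.HodgeTheory
open Literature.AlgebraicTopology.SingularHomology

namespace Summit.HodgeConjecture.HodgeConjecture.Theorems.BlochSeedDiscThree

section Binder

variable {𝒳 S : SchemeOver ℂ}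

/-- A Weil family is a Bloch family. (binder logic) [folklore] -/
theorem isBlochFamily_of_isWeilTypeFamily {n d : ℕ} {f : 𝒳 ⟶ S} (h : IsWeilTypeFamily n d f) :
    IsBlochFamily n f :=
  h.1

/-- (R) along a Weil family is (R). (binder logic) [folklore] -/
theorem rigidObstructed_of_weilRigidObstructed {n p d : ℕ} {P : AbelianVariety ℂ} {Z₀ : Scheme.{0}}
    {i : Z₀ ⟶ P.X.left} (h : WeilRigidObstructed n p d P Z₀ i) : RigidObstructed n p P.X Z₀ i := by
  obtain ⟨𝒳, S, f, s₀, e', hW, hcl, hno⟩ := h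
  exact ⟨𝒳, S, f, s₀, e', isBlochFamily_of_isWeilTypeFamily hW, hcl, hno⟩

end Binder

/-- **(R) — THE RIGIDITY THEOREM OF RECORD (typed; proof = memo §3, gap named there).** On the primitive Prym
`B₁ = im f = X₄₈^{new}(1,5,42)` of a CM-48 datum PINNED by `CMTypeIsPhi5` (n9), with `ψ₀ = (2s¹⁶+1)|_{B₁}` (`ψ₀² = −3`),
`dim B₁ = 8`: every Schoen cycle `Z ⊂ B₁` is RIGID-OBSTRUCTED in codimension 4 ALONG A `√-3`-WEIL FAMILY — there
is a Weil family of abelian eightfolds through `B₁` along which `cl(Z)` stays Hodge and over no étale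
neighbourhood of `[B₁]` does `Z` lift flatly. Pencil: the versal `(ℚ(√−3),(4,4))`-family `Sh¹⁶`; curve-built
cycles lift exactly over the Prym locus `𝒫̄^ét` (germ of dim 12 < 16; first-order image of rank 10 at the CM
member, CENSUS-R2 §9.1). The bankable barrier «curve-built cycles are never
seeds on cyclic Prym Weil families (deficit 4+ν)». [cite: Schoen1988HodgeWeil, Thm 2.0, §3]
[cite: Bloch1972Semiregularity, Thm. (7.4), Remark (7.5)] [cite: vanGeemen1994HodgeAV, 5.2–5.4, 6.12] -/
@[conjecture] def SchoenRigidity : Prop :=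
  ∀ (C : SchemeOver ℂ) (𝒥 : Jacobian C) (σ : C ⟶ C) (s f : 𝒥.J ⟶ 𝒥.J)
    (ψ₀ : AbelianVariety.image f ⟶ AbelianVariety.image f) (e : ProjectiveEmbedding (AbelianVariety.image f).X)
    (a : complexBetti (projectiveSpace e.n ℂ) 2),
    CM48Datum C 𝒥 σ s f → CMTypeIsPhi5 𝒥 s →
    ψ₀ ≫ AbelianVariety.imageι f = AbelianVariety.imageι f ≫ (2 • (End.of s ^ 16).asHom + 𝟙 𝒥.J) →
    (AbelianVariety.image f).dim = 2 * 4 → ψ₀ ≫ ψ₀ = -((3 : ℕ) • 𝟙 (AbelianVariety.image f)) →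
    ∀ (Z : Scheme.{0}) (κ : Z ⟶ (AbelianVariety.image f).X.left), SchoenCycleAt C 𝒥 σ f ψ₀ e a Z κ →
      WeilRigidObstructed (2 * 4) 4 3 (AbelianVariety.image f) Z κ

/-- **NO SCHOEN CYCLE IS A BLOCH SEED WITNESS** (the `SeedObstructedOn` shape of R2 on curve-built supports, with
the coheight binder, n8): granting (R) and the tree's typed Bloch theorem, a Schoen cycle `Z ⊂ B₁` which is a
regular immersion of codimension 4 (Bloch's l.c.i. hypothesis — UNDECIDED for `F_c`, round 2) with image of pure
codimension 4 in every chart is NOT Bloch-semiregular; in particular `(Z, κ, q)` is not a witness of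
`HasBlochSeedAt 4 B₁ h_K w` for any `w`. (If `F_c` is not l.c.i., it is not a witness either — for that reason.)
[cite: Bloch1972Semiregularity, Thm. (7.4), Remark (7.5)] [cite: Schoen1988HodgeWeil, Thm 2.0] -/
theorem schoenCycle_not_blochSemiregular (hR : SchoenRigidity) (hB : Bloch1972_semiregularSubschemeLifts)
    (C : SchemeOver ℂ) (𝒥 : Jacobian C) (σ : C ⟶ C) (s f : 𝒥.J ⟶ 𝒥.J)
    (ψ₀ : AbelianVariety.image f ⟶ AbelianVariety.image f) (e : ProjectiveEmbedding (AbelianVariety.image f).X)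
    (a : complexBetti (projectiveSpace e.n ℂ) 2) (hD : CM48Datum C 𝒥 σ s f) (h5 : CMTypeIsPhi5 𝒥 s)
    (hψ : ψ₀ ≫ AbelianVariety.imageι f = AbelianVariety.imageι f ≫ (2 • (End.of s ^ 16).asHom + 𝟙 𝒥.J))
    (hdim : (AbelianVariety.image f).dim = 2 * 4) (hψψ : ψ₀ ≫ ψ₀ = -((3 : ℕ) • 𝟙 (AbelianVariety.image f)))
    (Z : Scheme.{0}) (κ : Z ⟶ (AbelianVariety.image f).X.left) (hZ : SchoenCycleAt C 𝒥 σ f ψ₀ e a Z κ)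
    (hreg : IsRegularImmersionOfCodim κ 4)
    (hpure : ∀ (X₁ : SchemeOver ℂ) (e₁ : (AbelianVariety.image f).X ≅ X₁) (z : Z), ∃ z' : Z,
      Order.coheight ((κ ≫ e₁.hom.left).base z') = (4 : ℕ∞) ∧ (κ ≫ e₁.hom.left).base z' ⤳ (κ ≫ e₁.hom.left).base z) :
    ¬ IsBlochSemiregular κ (2 * 4) 4 :=
  not_isBlochSemiregular_of_rigidObstructed hB
    (rigidObstructed_of_weilRigidObstructed (hR C 𝒥 σ s f ψ₀ e a hD h5 hψ hdim hψψ Z κ hZ)) hreg hpure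

/-- **… hence the scheme-level doors give nothing at `F_c`**: under (R), for every Schoen cycle there is a Weil
family along which its class stays Hodge but it has no étale-local flat lift — the common conclusion shape of
Bloch (7.4), Buchweitz–Flenner Thm. 5.2 (embedded deformations of `Z₀` along the Hodge locus, which for a Weil
family is the whole base) and the `T¹`-of-the-pair door. Binder shuffle. [cite: BuchweitzFlenner2003, Thm. 5.2]
[cite: Bloch1972Semiregularity, Thm. (7.4)] -/
theorem schoenCycle_noLift_along_some_weilFamily (hR : SchoenRigidity)
    (C : SchemeOver ℂ) (𝒥 : Jacobian C) (σ : C ⟶ C) (s f : 𝒥.J ⟶ 𝒥.J)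
    (ψ₀ : AbelianVariety.image f ⟶ AbelianVariety.image f) (e : ProjectiveEmbedding (AbelianVariety.image f).X)
    (a : complexBetti (projectiveSpace e.n ℂ) 2) (hD : CM48Datum C 𝒥 σ s f) (h5 : CMTypeIsPhi5 𝒥 s)
    (hψ : ψ₀ ≫ AbelianVariety.imageι f = AbelianVariety.imageι f ≫ (2 • (End.of s ^ 16).asHom + 𝟙 𝒥.J))
    (hdim : (AbelianVariety.image f).dim = 2 * 4) (hψψ : ψ₀ ≫ ψ₀ = -((3 : ℕ) • 𝟙 (AbelianVariety.image f)))
    (Z : Scheme.{0}) (κ : Z ⟶ (AbelianVariety.image f).X.left) (hZ : SchoenCycleAt C 𝒥 σ f ψ₀ e a Z κ) :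
    ∃ (𝒳 S : SchemeOver ℂ) (g : 𝒳 ⟶ S) (s₀ : ComplexPoints S) (e' : (AbelianVariety.image f).X ≅ fiberOver g s₀),
      IsWeilTypeFamily (2 * 4) 3 g ∧ ClassStaysHodge g (2 * 4) 4 s₀ (κ ≫ e'.hom.left) ∧
      ¬ HasEtaleLocalFlatLift g s₀ Z (κ ≫ e'.hom.left) :=
  hR C 𝒥 σ s f ψ₀ e a hD h5 hψ hdim hψψ Z κ hZ

/-- **(Rʰ) — (R) ON HYPERBOLICALLY POLARISED FRAMES.** Verbatim `SchoenRigidity` with three extra antecedents on the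
auxiliary polarisation datum `(e, a)`: `a` RATIONAL, `a ≠ 0`, and `(B₁, ψ₀)` of HYPERBOLIC Weil type for
`h_K = 3·e^*a + ψ₀^*e^*a` — exactly the anchor binders of `HasLocallyAlgebraicWeilAnchor 4 3`
(`hasLocallyAlgebraicWeilAnchor_iff`) and of `HasHyperbolicBlochSeed 4 3` (MET ×3 for Schoen's `B₁`, CENSUS-R2 §7:
`h_K = E_B` rational `(1,1)`, `disc W_K = 3⁴ ≡ 1 = (−1)⁴` in `ℚˣ/Nm ℚ(√-3)ˣ`). `SchoenRigidity → SchoenRigidityHyp`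
(`schoenRigidityHyp_of_schoenRigidity`); (R) says more only on DEGENERATE frames (`a = 0`, `a` irrational, `h_K`
non-hyperbolic), which carry no seed and no anchor. [cite: Schoen1988HodgeWeil, Thm 2.0, §3]
[cite: vanGeemen1994HodgeAV, 5.2–5.4] [cite: Bloch1972Semiregularity, Thm. (7.4), Remark (7.5)] -/
@[conjecture] def SchoenRigidityHyp : Prop :=
  ∀ (C : SchemeOver ℂ) (𝒥 : Jacobian C) (σ : C ⟶ C) (s f : 𝒥.J ⟶ 𝒥.J)
    (ψ₀ : AbelianVariety.image f ⟶ AbelianVariety.image f) (e : ProjectiveEmbedding (AbelianVariety.image f).X)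
    (a : complexBetti (projectiveSpace e.n ℂ) 2),
    CM48Datum C 𝒥 σ s f → CMTypeIsPhi5 𝒥 s →
    ψ₀ ≫ AbelianVariety.imageι f = AbelianVariety.imageι f ≫ (2 • (End.of s ^ 16).asHom + 𝟙 𝒥.J) →
    (AbelianVariety.image f).dim = 2 * 4 → ψ₀ ≫ ψ₀ = -((3 : ℕ) • 𝟙 (AbelianVariety.image f)) →
    IsRationalClass a → a ≠ 0 → IsHyperbolicWeilType (AbelianVariety.image f) ψ₀ 4 (hK ψ₀ e a) →
    ∀ (Z : Scheme.{0}) (κ : Z ⟶ (AbelianVariety.image f).X.left), SchoenCycleAt C 𝒥 σ f ψ₀ e a Z κ →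
      WeilRigidObstructed (2 * 4) 4 3 (AbelianVariety.image f) Z κ

/-- (R) ⟹ (Rʰ): drop the three anchor antecedents. -/
theorem schoenRigidityHyp_of_schoenRigidity (h : SchoenRigidity) : SchoenRigidityHyp :=
  fun C 𝒥 σ s f ψ₀ e a hD h5 hψι hdim hψ _ _ _ Z κ hZ => h C 𝒥 σ s f ψ₀ e a hD h5 hψι hdim hψ Z κ hZ

end Summit.HodgeConjecture.HodgeConjecture.Theorems.BlochSeedDiscThree

end
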